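import Summits.BirchSwinnertonDyer.Rank1Residual.Additive.ChiBranchRatLowerDvdOdd
import Summits.BirchSwinnertonDyer.Rank1Residual.Additive.ChiBranchRatLowerDvdMultOdd
import Literature.NumberTheory.EllipticCurves.ZywinaCMImageProofs
import HarnessLib

/-!
# U3 / ROUTE-IW, the Λ-adic box (ROUTE-IW.md §3 H★, §8 P2): the ω-branch Eisenstein containment
# for the semistable twist at `3` ⟹ `MissingLowerBoundAt W 3` and `BSD(E,3)` on N11's potentially
# ordinary rows; the KILL-clause lemma (box + Kato ⟹ rational branch equality); box ⟹ A0
# (cell `bsd-uniform`, seat u3-p1; sibling of `IwasawaDescentAtThree`; self-contained)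

HONEST FRAMING (cell `bsd-uniform`, run/shared/lean/pub/bsd-uniform/, verbatim in every file): the
goal of the cell is a CONDUCTOR-FREE BSD formula in analytic rank `≤ 1` via UNIFORM CLASS THEOREMS
whose hypotheses are class predicates and PRINTED theorems, replacing per-curve certificates. THIS
FILE proves NO unconditional uniform theorem. It is prover task P2 of the ideation seat's
`u3/ROUTE-IW.md` (§8): the chain with the ONE non-printed step taken, in its NATIVE `Λ ⊗ ℚ₃` currency,
as the tree's two `@[conjecture]` nodes `ChiBranchRatLowerDvdOddAt W 3` ((G-ord)@3: one-sided RATIONAL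
Skinner–Urban-direction containment on the `ω = χ_{−3}` branch of the good-ordinary twist `E♭`) and
`ChiBranchRatLowerDvdMultOddAt W 3` ((M)@3: the same for the multiplicative twist) — H★ of the route,
printed ONLY for the trivial branch (S–U 2014 Thm. 3.6.1 "`χ_𝐟 = 1`", Remark (iii); Thm. 1 "`χ = 1`,
`p ∤ N`") — PLUS the route's H7 `μ`-certificate (one unit coefficient of `ϖ·L₃⁻`; per pair a finite
`3`-adic computation, uniformly = Greenberg's `μ = 0` on the branch: PROTOCOL L6 per-curve unless
stated as a class law — it is KEPT AS A NAMED BINDER and never dropped). Printed inputs (explicit named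
facts typed AT `3`): Kato Thm. 17.4 (3) half-eigenspace reading (`hKW`; used to upgrade H★ to the
rational equality and for the UPPER half), Delbourgo 2002 (A)+(B) at `3` (`hDel3`), Delbourgo 1998
Prop. 4 (`hDel`, `hDelX`), GZK, modularity. Reduction types covered: additive at `3`, potentially
multiplicative or (G)-ordinary, `ρ̄_{E,3}` surjective (N11), analytic rank `0`, off the anomalous
(G)-rows. RESIDUE: as in HOME/RESIDUE.md §U3 R3-IW-1…4 + the route's R3-5 (H★), R3-6 (H7), R3-7
(anomalous slack). No summit claim; nothing booked; no density number moves.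

WHY THIS IS NOVEL (one sentence): the prior cell's two X4 ends at `3` are composed into ONE N11-shaped
chain with the non-CM binder DISCHARGED from `surj(3)` (Zywina), the KILL clause of PLAN §U3 is a
kernel lemma (H★ + Kato's printed half ⟺ the rational `ω`-branch main-conjecture EQUALITY on both
cells: the IW lens isolates, and does not reduce, KMC₃-on-the-branch), and the Λ-box is shown to imply
the sibling file's `T = 0` binder A0 — so the three currencies (Λ-rational + `μ`, `T = 0` integral,
Miller) are kernel-linked on the class.

Sources: C. Skinner, E. Urban, Invent. Math. 195 (2014) Thm. 3.6.1 / Remark (iii), Thm. 3.6.4 (shape of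
H★; author pdf p. 41 l. 26–45, p. 2 l. 34–44, p. 43); K. Kato, Astérisque 295 (2004) Thm. 17.4 (3)
(p. 273); C. Wuthrich, Doc. Math. 19 (2014) Lemma 20 (p. 399; PROVED in the tree); D. Delbourgo 1998 /
2002 (as in the sibling); D. Zywina, arXiv:1508.07663 Prop. 1.14/1.16 (theorem
`WeierstrassCurve.not_hasSurjectiveModNGaloisRep_of_hasCM`); R. L. Miller 2011 Def. 1.1. Literature
sheet: `u3/WHY-NOT-3.md` §3.4, §4; route: `u3/ROUTE-IW.md` §3, §8. Theorems only (no `def`, no `sorry`).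
-/

noncomputable section

open scoped Classical NumberField MatrixGroups ModularForm

open CongruenceSubgroup WeierstrassCurve NumberField IsDedekindDomain
  Literature.NumberTheory.EllipticCurves
  Literature.NumberTheory.EllipticCurves.ModularForms
  Literature.NumberTheory.EllipticCurves.Rank1Residual
  Literature.NumberTheory.EllipticCurves.Rank1Residual.Typed
  Summit.BirchSwinnertonDyer.Rank1Residual
  Summit.BirchSwinnertonDyer.Rank1Residual.Additive

namespace Summit.BirchSwinnertonDyer.Uniform.U3

variable {W : WeierstrassCurve ℚ} [W.IsElliptic] [W.IsGloballyMinimal]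

/-! ### §1 The chain of ROUTE-IW §3 on N11 ∩ potentially ordinary (H★ + H7 + printed ⟹ LOWER, BSD) -/

/-- **ROUTE-IW chain, `Ш` currency** (route §8 `missingLowerBoundAt_three_of_iwChain`, non-CM binder
DISCHARGED): for `E/ℚ` globally minimal, X4 at `3` with `surj(3)`, additive potentially ordinary at
`3`, analytic rank `0`, off the anomalous (G)-rows — the boxed H★ (`hEisG` on the (G)-cell, `hEisM` on
the (M)-cell: one-sided RATIONAL Eisenstein containment on the `ω`-branch of the semistable twist) and
the `μ`-certificate H7 (`hcertG` / `hcertM`: ONE unit coefficient of `ϖ·L₃⁻`) give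
`ord₃ #Ш(E)_an ≤ ord₃ #Ш(E)`; printed inputs Kato Thm. 17.4 (3) (`hKW`, upgrade to the rational
equality), Delbourgo 2002 at `3` (`hDel3`), Delbourgo 1998 Prop. 4 exact on (M) (`hDelX`), GZK,
modularity. [cite: SkinnerUrban2014, Thm. 3.6.4 (p. 43) (shape only; nothing asserted)]
[cite: Kato2004Asterisque, Thm. 17.4 (3) (p. 273)] [cite: Delbourgo2002, Theorem (A), (B) (p. 40)]
[cite: Delbourgo1998, Prop. 4 (p. 144), §2.2 Lemma (ii) (p. 139)] [cite: Miller2011LMS, Def. 1.1] -/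
theorem missingLowerBoundAt_three_rankZero_of_surj_of_omegaBranchEisenstein [Fact (Nat.Prime 3)]
    (hKW : Wuthrich2014.kato_halfEigenCharIdeal_dvd_cyclotomicPrime_of_surjective)
    (hDel3 : Delbourgo2002.mainTheorem_three)
    (hDelX : Delbourgo1998.prop4_rankZero_constantCoeff_eq_unit_mul_of_potMult)
    (hGZK : rank_eq_analyticRank_of_analyticRank_le_one) (hmod : hasEntireLFunction_rat)
    (hmodD : nonempty_modularParametrizationData)
    (hX : ClassX4 W 3) (hsurj : Surj W 3) (hord : Additive.PotMult W 3 ∨ TypeGOrd W 3)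
    (hr : W.analyticRank = 0) (hna : TypeGOrd W 3 → Delbourgo2002.ReductionNonAnomalous W 3)
    (hEisG : TypeGOrd W 3 → ChiBranchRatLowerDvdOddAt W 3)
    (hEisM : Additive.PotMult W 3 → ChiBranchRatLowerDvdMultOddAt W 3)
    (hcertG : TypeGOrd W 3 →
      ∀ (V : WeierstrassCurve ℚ) [V.IsElliptic] [V.IsGloballyMinimal] (C : VariableChange ℚ),
      GoodOrd V 3 → C • V.quadraticTwist (-(3 : ℚ)) = W →
      ∀ {N : ℕ} [NeZero N] (f : CuspForm (Gamma0 N) 2), IsNewformOf V f →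
      ∀ ϖ : ℚ, (ϖ : ℝ) * V.imaginaryPeriodRat = minusPeriod f →
      ∃ n : ℕ, ‖PowerSeries.coeff n
        (PowerSeries.C (ϖ : ℚ_[3]) * padicLFunctionMinusBranch f (unitRoot V 3 : ℚ_[3]) (3 / 2))‖ = 1)
    (hcertM : Additive.PotMult W 3 → MultOddBranchUnitCoeffCert W 3) :
    MissingLowerBoundAt W 3 := by
  rcases hord with hM | hG
  · exact AdditivePotMult.ClassX4M.missingLowerBoundAt_rankZero_of_ratLowerDvdMultOdd_of_unitCoeff_of_surj
      hKW hDelX hGZK hmod hmodD ⟨hX, hX.2.1, hM⟩ (by decide) hr hsurj (hEisM hM) (hcertM hM)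
  · exact ClassX4Gord.missingLowerBoundAt_three_rankZero_of_ratLowerDvdOdd_of_unitCoeff_of_surj hKW hDel3
      hGZK hmod hmodD ⟨hX, hG⟩
      (fun hCM ↦ W.not_hasSurjectiveModNGaloisRep_of_hasCM hCM Nat.prime_three (by decide) hsurj)
      hr hsurj (hna hG) (hEisG hG) (hcertG hG)

/-- **ROUTE-IW chain, `BSD(E,3)` currency**: same hypotheses plus Delbourgo 1998 Prop. 4 (`hDel`, for
the UPPER half) ⟹ Miller's `BSD(E,3)`; Kato's half `hKW` serves both the upgrade of H★ and the upper
half (no extra Kato binder). [cite: Kato2004Asterisque, Thm. 17.4 (3) (p. 273)]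
[cite: SkinnerUrban2014, Thm. 3.6.4 (p. 43) (shape only; nothing asserted)] [cite: Delbourgo2002, Theorem (A), (B) (p. 40)]
[cite: Delbourgo1998, Prop. 4 (p. 144)] [cite: Miller2011LMS, §1 and Def. 1.1] -/
theorem bsdp_three_rankZero_of_surj_of_omegaBranchEisenstein [Fact (Nat.Prime 3)]
    (hKW : Wuthrich2014.kato_halfEigenCharIdeal_dvd_cyclotomicPrime_of_surjective)
    (hDel3 : Delbourgo2002.mainTheorem_three)
    (hDel : Delbourgo1998.prop4_rankZero_pow_dvd_constantCoeff)
    (hDelX : Delbourgo1998.prop4_rankZero_constantCoeff_eq_unit_mul_of_potMult)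
    (hGZK : rank_eq_analyticRank_of_analyticRank_le_one) (hmod : hasEntireLFunction_rat)
    (hmodD : nonempty_modularParametrizationData)
    (hX : ClassX4 W 3) (hsurj : Surj W 3) (hord : Additive.PotMult W 3 ∨ TypeGOrd W 3)
    (hr : W.analyticRank = 0) (hna : TypeGOrd W 3 → Delbourgo2002.ReductionNonAnomalous W 3)
    (hEisG : TypeGOrd W 3 → ChiBranchRatLowerDvdOddAt W 3)
    (hEisM : Additive.PotMult W 3 → ChiBranchRatLowerDvdMultOddAt W 3)
    (hcertG : TypeGOrd W 3 →
      ∀ (V : WeierstrassCurve ℚ) [V.IsElliptic] [V.IsGloballyMinimal] (C : VariableChange ℚ),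
      GoodOrd V 3 → C • V.quadraticTwist (-(3 : ℚ)) = W →
      ∀ {N : ℕ} [NeZero N] (f : CuspForm (Gamma0 N) 2), IsNewformOf V f →
      ∀ ϖ : ℚ, (ϖ : ℝ) * V.imaginaryPeriodRat = minusPeriod f →
      ∃ n : ℕ, ‖PowerSeries.coeff n
        (PowerSeries.C (ϖ : ℚ_[3]) * padicLFunctionMinusBranch f (unitRoot V 3 : ℚ_[3]) (3 / 2))‖ = 1)
    (hcertM : Additive.PotMult W 3 → MultOddBranchUnitCoeffCert W 3) :
    BSDp W 3 := by
  rcases hord with hM | hG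
  · exact AdditivePotMult.ClassX4M.bsdp_three_rankZero_of_ratLowerDvdMultOdd_of_unitCoeff_of_surj hKW
      hDelX hDel hGZK hmod hmodD ⟨hX, hX.2.1, hM⟩ hr hsurj (hEisM hM) (hcertM hM)
  · exact ClassX4Gord.bsdp_three_rankZero_of_ratLowerDvdOdd_of_unitCoeff_of_surj hKW hDel3 hDel hGZK hmod
      hmodD ⟨hX, hG⟩
      (fun hCM ↦ W.not_hasSurjectiveModNGaloisRep_of_hasCM hCM Nat.prime_three (by decide) hsurj)
      hr hsurj (hna hG) (hEisG hG) (hcertG hG)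

/-! ### §2 The KILL clause of PLAN §U3 as a kernel lemma: H★ + Kato's printed half ⟺ the rational
`ω`-branch main-conjecture EQUALITY (the lens isolates KMC₃-on-the-branch, it does not reduce it) -/

/-- **Box + Kato ⟹ rational branch equality, both cells** (route §8 `chiBranchRatCharEqOddAt_three_of_box`
extended to (M)): on X4 ∧ `surj(3)` (tower from `surj(3)` by Wuthrich's Lemma 20, PROVED), the
one-sided containment H★ and Kato's `⊆` give the EQUALITY `char_Λ X(E/ℚ_∞) = (3^k ϖ L₃⁻)` in
`Λ ⊗ ℚ₃` — `ChiBranchRatCharEqOddAt W 3` on (G), `ChiBranchRatCharEqMultOddAt W 3` on (M).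
[cite: Kato2004Asterisque, Thm. 17.4 (3) (p. 273)] [cite: Wuthrich2014, Lemma 20 (p. 399)]
[cite: SkinnerUrban2014, Thm. 3.6.4, proof (p. 43) (shape only)] -/
theorem chiBranchRatCharEq_three_of_surj_of_omegaBranchEisenstein [Fact (Nat.Prime 3)]
    (hKW : Wuthrich2014.kato_halfEigenCharIdeal_dvd_cyclotomicPrime_of_surjective)
    (hX : ClassX4 W 3) (hsurj : Surj W 3)
    (hEisG : TypeGOrd W 3 → ChiBranchRatLowerDvdOddAt W 3)
    (hEisM : Additive.PotMult W 3 → ChiBranchRatLowerDvdMultOddAt W 3) :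
    (TypeGOrd W 3 → ChiBranchRatCharEqOddAt W 3) ∧
      (Additive.PotMult W 3 → ChiBranchRatCharEqMultOddAt W 3) :=
  ⟨fun hG ↦ ClassX4Gord.chiBranchRatCharEqOddAt_three_of_katoHalf_of_ratLowerDvd_of_surj hKW ⟨hX, hG⟩
      hsurj (hEisG hG),
    fun hM ↦ AdditivePotMult.ClassX4M.chiBranchRatCharEqMultOddAt_of_ratLowerDvd_of_surj hKW
      ⟨hX, hX.2.1, hM⟩ hsurj (hEisM hM)⟩

omit [W.IsGloballyMinimal] in
/-- **Conversely the rational equality gives back the box** (definitional unpacking, route §8: "left to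
u3-p1"): `ChiBranchRatCharEqOddAt W 3 → ChiBranchRatLowerDvdOddAt W 3` and the (M) twin — the tree's
`chiBranchRatLowerDvdOddAt_of_ratCharEqOdd` / `chiBranchRatLowerDvdMultOddAt_of_ratCharEqMultOdd`. So on
X4 ∧ `surj(3)`, granted Kato, H★ ⟺ rational KMC₃ on the `ω`-branch: no reduction, exact isolation.
[cite: SkinnerUrban2014, Thm. 3.6.4 (p. 43) (shape only; nothing asserted)] -/
theorem omegaBranchEisenstein_three_of_chiBranchRatCharEq [Fact (Nat.Prime 3)]
    (hEqG : TypeGOrd W 3 → ChiBranchRatCharEqOddAt W 3)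
    (hEqM : Additive.PotMult W 3 → ChiBranchRatCharEqMultOddAt W 3) :
    (TypeGOrd W 3 → ChiBranchRatLowerDvdOddAt W 3) ∧
      (Additive.PotMult W 3 → ChiBranchRatLowerDvdMultOddAt W 3) :=
  ⟨fun hG ↦ chiBranchRatLowerDvdOddAt_of_ratCharEqOdd W 3 (hEqG hG),
    fun hM ↦ chiBranchRatLowerDvdMultOddAt_of_ratCharEqMultOdd W 3 (hEqM hM)⟩

/-! ### §3 The Λ-box implies the sibling's `T = 0` binder A0 (three currencies, one chain) -/

/-- **H★ + H7 + Kato ⟹ A0 = `CycLowerLeadingTermAt W 3`** on X4 ∧ `surj(3)` ∧ potentially ordinary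
at `3`: the rational equality of §2 with ONE unit coefficient pins the `3`-power (`k ≥ 0`) and the
Birch–Pal identity (Pal 2012 Thm. 3.2 for `d < 0`, PROVED) moves the constant term to `L(E,1)/Ω_E`
(tree ends `ClassX4Gord.cycLowerLeadingTermAt_of_ratCharEqOdd_of_unitCoeff`,
`ClassX4M.cycLowerLeadingTermAt_of_ratCharEqMultOdd_of_unitCoeff`). Hence every consequence of A0 in
the sibling file (`IwasawaDescentAtThree`: `MissingLowerBoundAt`, `BSDp`, the `iff`s) is available
from the route's box. [cite: MazurTateTeitelbaum1986Invent, §I.14] [cite: Pal2012, Thm. 3.2]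
[cite: Kato2004Asterisque, Thm. 17.4 (3) (p. 273)] -/
theorem cycLowerLeadingTerm_three_of_surj_of_omegaBranchEisenstein [Fact (Nat.Prime 3)]
    (hKW : Wuthrich2014.kato_halfEigenCharIdeal_dvd_cyclotomicPrime_of_surjective)
    (hmod : hasEntireLFunction_rat) (hmodD : nonempty_modularParametrizationData)
    (hX : ClassX4 W 3) (hsurj : Surj W 3) (hord : Additive.PotMult W 3 ∨ TypeGOrd W 3)
    (hEisG : TypeGOrd W 3 → ChiBranchRatLowerDvdOddAt W 3)
    (hEisM : Additive.PotMult W 3 → ChiBranchRatLowerDvdMultOddAt W 3)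
    (hcertG : TypeGOrd W 3 →
      ∀ (V : WeierstrassCurve ℚ) [V.IsElliptic] [V.IsGloballyMinimal] (C : VariableChange ℚ),
      GoodOrd V 3 → C • V.quadraticTwist (-(3 : ℚ)) = W →
      ∀ {N : ℕ} [NeZero N] (f : CuspForm (Gamma0 N) 2), IsNewformOf V f →
      ∀ ϖ : ℚ, (ϖ : ℝ) * V.imaginaryPeriodRat = minusPeriod f →
      ∃ n : ℕ, ‖PowerSeries.coeff n
        (PowerSeries.C (ϖ : ℚ_[3]) * padicLFunctionMinusBranch f (unitRoot V 3 : ℚ_[3]) (3 / 2))‖ = 1)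
    (hcertM : Additive.PotMult W 3 → MultOddBranchUnitCoeffCert W 3) :
    CycLowerLeadingTermAt W 3 := by
  obtain ⟨hEqG, hEqM⟩ :=
    chiBranchRatCharEq_three_of_surj_of_omegaBranchEisenstein hKW hX hsurj hEisG hEisM
  rcases hord with hM | hG
  · exact AdditivePotMult.ClassX4M.cycLowerLeadingTermAt_of_ratCharEqMultOdd_of_unitCoeff hmod hmodD
      ⟨hX, hX.2.1, hM⟩ (by decide) (hEqM hM) (hcertM hM)
  · exact ClassX4Gord.cycLowerLeadingTermAt_of_ratCharEqOdd_of_unitCoeff hmod hmodD ⟨hX, hG⟩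
      (semistabilityIndex_eq_two_of_typeG_three W hG.typeG hX.2.1) (by decide) (hEqG hG) (hcertG hG)

/-! ### §4 The `∀`-closure in `N10.LowerHalf`-shape restricted to `surj(3)` (route §8 P2, last item) -/

/-- **Class level**: if H★ and H7 hold on every X4 ∧ `surj(3)` ∧ `r_an = 0` potentially-ordinary
additive row at `3`, then so does the LOWER half `ord₃ #Ш_an ≤ ord₃ #Ш` (off the anomalous (G)-rows) —
the conditional uniform theorem of ROUTE-IW with its two non-printed binders displayed (H★ boxed, H7
certificate-shaped), everything else printed. [cite: SkinnerUrban2014, Thm. 3.6.4 (p. 43) (shape only; nothing asserted)]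
[cite: Kato2004Asterisque, Thm. 17.4 (3) (p. 273)] [cite: Delbourgo2002, Theorem (A), (B) (p. 40)]
[cite: Delbourgo1998, Prop. 4 (p. 144)] [cite: Miller2011LMS, Def. 1.1] -/
theorem forall_missingLowerBoundAt_three_of_surj_of_forall_omegaBranchEisenstein [Fact (Nat.Prime 3)]
    (hKW : Wuthrich2014.kato_halfEigenCharIdeal_dvd_cyclotomicPrime_of_surjective)
    (hDel3 : Delbourgo2002.mainTheorem_three)
    (hDelX : Delbourgo1998.prop4_rankZero_constantCoeff_eq_unit_mul_of_potMult)
    (hGZK : rank_eq_analyticRank_of_analyticRank_le_one) (hmod : hasEntireLFunction_rat)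
    (hmodD : nonempty_modularParametrizationData)
    (hEis : ∀ (W : WeierstrassCurve ℚ) [W.IsElliptic] [W.IsGloballyMinimal],
      ClassX4 W 3 → Surj W 3 → W.analyticRank = 0 →
        (TypeGOrd W 3 → ChiBranchRatLowerDvdOddAt W 3) ∧
        (Additive.PotMult W 3 → ChiBranchRatLowerDvdMultOddAt W 3))
    (hcert : ∀ (W : WeierstrassCurve ℚ) [W.IsElliptic] [W.IsGloballyMinimal],
      ClassX4 W 3 → Surj W 3 → W.analyticRank = 0 →
        (TypeGOrd W 3 →
          ∀ (V : WeierstrassCurve ℚ) [V.IsElliptic] [V.IsGloballyMinimal] (C : VariableChange ℚ),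
          GoodOrd V 3 → C • V.quadraticTwist (-(3 : ℚ)) = W →
          ∀ {N : ℕ} [NeZero N] (f : CuspForm (Gamma0 N) 2), IsNewformOf V f →
          ∀ ϖ : ℚ, (ϖ : ℝ) * V.imaginaryPeriodRat = minusPeriod f →
          ∃ n : ℕ, ‖PowerSeries.coeff n
            (PowerSeries.C (ϖ : ℚ_[3]) * padicLFunctionMinusBranch f (unitRoot V 3 : ℚ_[3]) (3 / 2))‖ = 1) ∧
        (Additive.PotMult W 3 → MultOddBranchUnitCoeffCert W 3)) :
    ∀ (W : WeierstrassCurve ℚ) [W.IsElliptic] [W.IsGloballyMinimal],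
      ClassX4 W 3 → Surj W 3 → W.analyticRank = 0 → (Additive.PotMult W 3 ∨ TypeGOrd W 3) →
        (TypeGOrd W 3 → Delbourgo2002.ReductionNonAnomalous W 3) → MissingLowerBoundAt W 3 :=
  fun W _ _ hX hsurj hr hord hna ↦
    missingLowerBoundAt_three_rankZero_of_surj_of_omegaBranchEisenstein hKW hDel3 hDelX hGZK hmod hmodD hX
      hsurj hord hr hna (hEis W hX hsurj hr).1 (hEis W hX hsurj hr).2 (hcert W hX hsurj hr).1
      (hcert W hX hsurj hr).2

end Summit.BirchSwinnertonDyer.Uniform.U3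

end
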